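import Summits.BirchSwinnertonDyer.Rank1Residual.GaloisImage.KuriharaLowerBoundAssemblyAt
import HarnessLib

/-!
# Route `KimAtThreeKolyvagin` (rung W2), crux `ShallowEqDeepOffKatoStratum` (item 19599), stub
# `stub_additiveDefect`: the TWO-EXPONENT form of n1011's (a′) assembly — the additive defect `e`
# (`e = v₃(c₃) + v₃(c_{D₀})` in print: Kodaira IV/IV*, `3 ∣` Manin constant) CANCELS

Cell `bsd-addord`, seat `bsd-addord-w2-acc6` (PROGRAMME PART 1b, plan g16 ACCEL-LIST (6)), item
`stmt-BirchSwinnertonDyer-19599` (`--supports`, helper).  Theorems only (no definition, no named fact, no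
`sorry`); nothing asserted about any curve; crux 19599 stays OPEN.

WHAT.  n1011's `Assembly.pow_dvd_natCard_selmerGroup_of_certificate_at` (GaloisImage/KuriharaLowerBoundAssemblyAt)
is the heart of the Kato-stratum END theorem: from the Kato–Kurihara dictionary witnesses at a shallow depth `k`
and a deep depth `k′` — value law `Λ(loc_{v₃} κ_d) = u_d · 3^t · δ̃_{n(d)}` (Kim AJM 148 Thm. 3.13 shape, additive
`3` with `3 ∤ c₃`, `t` = the `3`-torsion exponent) — a certificate `δ̃_n ≢ 0 (mod 3^j)` at a level `n` of the
shallow datum and the visible `L`-value `δ̃_1 ≡ 3^v · unit` at the deep modulus, it proves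
`3^{v+1−j} ∣ #Sel_{3^{k′+1}}(E/ℚ)`.  On the ADDITIVE-DEFECT rows of crux 19599 (Kodaira IV/IV*: `c₃ = 3`; or
`3 ∣ c_{D₀}`) the local lattice `exp*_ω(H¹(ℚ₃,T₃E)) = 3^{v₃(c₃)−t}ℤ₃·ω` (cell memo kim3/KIM3-PROOF.md Lemma L/L′;
Kim AJM Rem. 3.7 / Lemma 3.9 are stated for `p ∤ c_p` only) and the period ratio `Ω(W) = u·Ω⁺_f`,
`|u|₃ = |c₀|₃` (`KimAtThreeShallowEqDeepPeriod.exists_optimal_period_ratio`) shift the value law to the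
TWO-EXPONENT form
  `3^e · Λ(loc_{v₃} κ_d) = u_d · 3^t · δ̃_{n(d)}`  (`e = v₃(c₃) + v₃(c₀)`, the SAME `e` at every level and depth).
THIS FILE: `pow_dvd_natCard_selmerGroup_of_certificate_twoExp` — the same conclusion `3^{v+1−j} ∣ #Sel_{3^{k′+1}}`
from the two-exponent witnesses, for EVERY `e : ℕ`: the exponent cancels.  Mechanism (the ACCEL-LIST (6) line
«shallow and deep vanishing orders shift by the same v₃(c₃)»): (i) SHALLOW — n1011's
`Shallow.not_pow_dvd_of_certificate_levelwise` applied to the scaled functional `L = 3^e · (Λ ∘ loc)` gives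
`L(κ′_n) ∉ (3^{t+j})`, whence the SHARP certificate `¬ 3^{t+j−e} ∣ a` for Kato's scalar (`κ′ = a • g`), better by
`e` than the lemma's own `¬ 3^{t+j} ∣ a`; (ii) DEEP — `3^e · a′ · Λ(loc g′_∅) = 3^{t+v} · unit` gives
`Λ(loc g′_∅) = 3^{t+v−e−α} · unit` (`a′ = 3^α b`, `α < t+j−e`), and n1011's deep ledger
`DeepLedger.pow_dvd_natCard_selmerGroup_kummer` gives `3^{t+v−e−α} ∣ #Sel`, with `t+v−e−α ≥ v+1−j`.
The witnesses enter UNPACKED (explicit `κ, Λ, κ′` at depth `k`, `κu, Λu, κu′` at depth `k′`, the reduction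
compatibility of `κ′`), so the theorem is keyed to NO port predicate; a two-exponent port (the residual OBJECT of
the additive-defect rows, w2-c4 g5 WANTED 14:43:44Z «PORT_nonadd@3 + its IV/IV* two-exponent sibling») only has
to produce these binders.  At `e = 0` the hypotheses are literally the clauses of n1011's `KatoKuriharaWitnessAt`
(`twoExp_dict_of_witnessAt`).

References: [Kim2022StructureSelmer] Thm. 1.9 (6), Thm. 3.13, Rem. 3.7, Lemma 3.9; [Kim2025RefinedTNC] Thm 1.1,
§8.1.2; [Sakamoto2024] Thm. 4.4; [Kato2004Asterisque] Thm. 12.5 (1); [MazurRubin2004] Thm. 3.2.4, App. A (33);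
cell memo `run/shared/lean/pub/bsd-addord/kim3/KIM3-PROOF.md` §4.4 (e = v₃(c₃) + v₃(c₀) + b − t), Lemma L/L′.
-/

set_option autoImplicit false
-- the Theorems namespace of a single-conjunct summit repeats the summit name by design (D-0017)
set_option linter.dupNamespace false

noncomputable section

open scoped Classical NumberField ContRepresentation
open Function NumberField IsDedekindDomain WeierstrassCurve
  Literature.NumberTheory.EllipticCurves Literature.NumberTheory.EllipticCurves.ModularForms
  Literature.NumberTheory.EllipticCurves.Rank1Residual
  Literature.NumberTheory.GaloisRepresentations
  Literature.NumberTheory.GaloisRepresentations.DiscreteGaloisModule Literature.NumberTheory.GaloisCohomology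
  Summit.BirchSwinnertonDyer.Rank1Residual.GaloisImage
  Summit.BirchSwinnertonDyer.Rank1Residual.GaloisImage.Assembly

namespace Summit.BirchSwinnertonDyer.BirchSwinnertonDyer.Theorems.KimAtThreeTwoExponentAssembly

/-- **The one-exponent witness clauses are the two-exponent clauses at `e = 0`**: the (DICT3) clause of
n1011's `KatoKuriharaWitnessAt W k t D v₃ P κ Λ κ′` gives, at every level `d` of `D`,
`3^0 · Λ(loc κ_d) = u · 3^t · δ̃_{n(d)}` — so nothing below is stronger than what the Kato stratum already
grants. [cite: Kim2022StructureSelmer, Thm. 3.13 (arXiv p. 17)] -/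
theorem twoExp_dict_of_witnessAt
    (W : WeierstrassCurve ℚ) [W.IsElliptic] [W.IsGloballyMinimal] (k t : ℕ)
    (D : KolyvaginDatum (W.torsionGaloisModule (((3 : ℕ) : ℤ) ^ k * ((3 : ℕ) : ℤ))))
    (v₃ : HeightOneSpectrum (𝓞 ℚ)) {N : ℕ} [NeZero N] (P : ModularParametrizationData W N)
    (κ : Finset (HeightOneSpectrum (𝓞 ℚ)) →
      galoisCohomology (W.torsionGaloisModule (((3 : ℕ) : ℤ) ^ k * ((3 : ℕ) : ℤ))) 1)
    (Λ : galoisCohomology ((W.torsionGaloisModule (((3 : ℕ) : ℤ) ^ k * ((3 : ℕ) : ℤ))).toLocal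
      (Sum.inr v₃)) 1 →+ ZMod (3 ^ (k + 1)))
    (κ' : Finset (HeightOneSpectrum (𝓞 ℚ)) →
      galoisCohomology (W.torsionGaloisModule (((3 : ℕ) : ℤ) ^ k * ((3 : ℕ) : ℤ))) 1)
    (hW : KatoKuriharaWitnessAt W k t D v₃ P κ Λ κ') :
    ∀ (d : Finset (HeightOneSpectrum (𝓞 ℚ))), D.IsLevel d →
      ∃ (u : (ZMod (3 ^ (k + 1)))ˣ)
        (ψ : (ℓ : ℕ) → (ZMod ℓ)ˣ →* Multiplicative (ZMod (3 ^ (k + 1)))),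
        (∀ q ∈ d, Function.Surjective (ψ (Ideal.absNorm q.asIdeal))) ∧
        haveI : NeZero (∏ q ∈ d, Ideal.absNorm q.asIdeal) :=
          ⟨Finset.prod_ne_zero_iff.2 fun q _ h => q.ne_bot (Ideal.absNorm_eq_zero_iff.1 h)⟩
        ((3 ^ 0 : ℕ) : ZMod (3 ^ (k + 1))) *
            Λ (galoisCohomology.localization _ (Sum.inr v₃) 1 (κ d)) =
          (u : ZMod (3 ^ (k + 1))) * (3 : ZMod (3 ^ (k + 1))) ^ t *
            kuriharaNumber P.f (3 ^ (k + 1)) (∏ q ∈ d, Ideal.absNorm q.asIdeal) ψ := by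
  intro d hd
  obtain ⟨-, -, -, -, hdict⟩ := hW
  obtain ⟨u, ψ, hψ, hL⟩ := hdict d hd
  exact ⟨u, ψ, hψ, by simpa using hL⟩

/-- **The two-exponent (a′) assembly: the additive defect cancels.**  Row data: `W/ℚ` globally minimal, a
place `v₃ ∣ 3`, a parametrisation datum `P`; depths `k ≤ k′`, Kolyvagin data `D` (depth `k`), `D′` (depth `k′`),
the reduction `red` (pinned on points).  WITNESSES (the clauses of a two-exponent Kato–Kurihara dictionary,
UNPACKED): at depth `k` Kato's family `κ`, a functional `Λ` on `H¹(ℚ₃, E[3^{k+1}])`, a Kolyvagin system `κ′`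
unitriangularly congruent to `κ` at the levels of `D`, and the value law
`3^e · Λ(loc κ_d) = u_d · 3^t · δ̃_{n(d)}` at every level; at depth `k′` the same objects `κu, Λu, κu′` with
`κu′_∅ = κu_∅`, `Λu` onto `ℤ/3^{k′+1}` on `𝓕_can(v₃)` with kernel the Kummer part, and the value law at `∅`;
the reduction compatibility `red_*(κu′_d) = κ′_d` (one Euler system).  FURTHER INPUTS exactly as n1011's
`pow_dvd_natCard_selmerGroup_of_certificate_at`: generators `g`, `g′` of the two Kolyvagin-system groups
([S24] Thm. 4.4 (1) instances), the Poitou–Tate family `inv′` at modulus `3^{k′+1}` with its properties,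
`hEP`, an admissible `T ∋ v₃`, [S24] Thm. 4.4 (2) at `(k′, ∅)` in ORDER form, the scalar transport `htr`,
the certificate `δ̃^{(j)}_n(ψ₀) ≠ 0` at a level `n` of `D` with `t + j ≤ k + 1`, the vanishing of the proper
sub-level numbers mod `3^j`, `3`-integrality of the symbols, the `L`-value `δ̃_1 = 3^v · unit (mod 3^{k′+1})`,
the exponent `3^X` of `Sel_{3^{k′+1}}` and the depth `X + t + v < k′ + 1`.  OUTPUT, for EVERY `e`:
**`3^{v+1−j} ∣ #Sel_{3^{k′+1}}(E/ℚ)`** — the exponent `e` of the additive defect does not enter.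
[cite: Kim2022StructureSelmer, Thm. 1.9 (6) and Thm. 3.13] [cite: Kim2025RefinedTNC, Thm 1.1 and §8.1.2]
[cite: Sakamoto2024, Thm. 4.4 (p. 926)] [cite: MazurRubin2004, Thm. 3.2.4 and App. A (33)] -/
theorem pow_dvd_natCard_selmerGroup_of_certificate_twoExp
    (W : WeierstrassCurve ℚ) [W.IsElliptic] [W.IsGloballyMinimal] (t e k k' : ℕ)
    (D : KolyvaginDatum (W.torsionGaloisModule (((3 : ℕ) : ℤ) ^ k * ((3 : ℕ) : ℤ))))
    (D' : KolyvaginDatum (W.torsionGaloisModule (((3 : ℕ) : ℤ) ^ k' * ((3 : ℕ) : ℤ))))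
    (red : (W.torsionGaloisModule (((3 : ℕ) : ℤ) ^ k' * ((3 : ℕ) : ℤ))).toContRepresentation →ⁱL
      (W.torsionGaloisModule (((3 : ℕ) : ℤ) ^ k * ((3 : ℕ) : ℤ))).toContRepresentation)
    (v₃ : HeightOneSpectrum (𝓞 ℚ)) (hv₃ : ((3 : ℕ) : 𝓞 ℚ) ∈ v₃.asIdeal)
    {N : ℕ} [NeZero N] (P : ModularParametrizationData W N)
    -- the two-exponent witnesses at the shallow depth `k`
    (κ : Finset (HeightOneSpectrum (𝓞 ℚ)) →
      galoisCohomology (W.torsionGaloisModule (((3 : ℕ) : ℤ) ^ k * ((3 : ℕ) : ℤ))) 1)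
    (Λ : galoisCohomology ((W.torsionGaloisModule (((3 : ℕ) : ℤ) ^ k * ((3 : ℕ) : ℤ))).toLocal
      (Sum.inr v₃)) 1 →+ ZMod (3 ^ (k + 1)))
    (κ' : Finset (HeightOneSpectrum (𝓞 ℚ)) →
      galoisCohomology (W.torsionGaloisModule (((3 : ℕ) : ℤ) ^ k * ((3 : ℕ) : ℤ))) 1)
    (hKS : κ' ∈ D.kolyvaginSystems (propagatedSelmerStructure W 3 k))
    (hbr : ∀ d, D.IsLevel d → κ' d - κ d ∈ AddSubgroup.closure {x | ∃ c, c ⊂ d ∧ x = κ c})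
    (hdictk : ∀ (d : Finset (HeightOneSpectrum (𝓞 ℚ))), D.IsLevel d →
      ∃ (u : (ZMod (3 ^ (k + 1)))ˣ)
        (ψ : (ℓ : ℕ) → (ZMod ℓ)ˣ →* Multiplicative (ZMod (3 ^ (k + 1)))),
        (∀ q ∈ d, Function.Surjective (ψ (Ideal.absNorm q.asIdeal))) ∧
        haveI : NeZero (∏ q ∈ d, Ideal.absNorm q.asIdeal) :=
          ⟨Finset.prod_ne_zero_iff.2 fun q _ h => q.ne_bot (Ideal.absNorm_eq_zero_iff.1 h)⟩
        ((3 ^ e : ℕ) : ZMod (3 ^ (k + 1))) *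
            Λ (galoisCohomology.localization _ (Sum.inr v₃) 1 (κ d)) =
          (u : ZMod (3 ^ (k + 1))) * (3 : ZMod (3 ^ (k + 1))) ^ t *
            kuriharaNumber P.f (3 ^ (k + 1)) (∏ q ∈ d, Ideal.absNorm q.asIdeal) ψ)
    -- the two-exponent witnesses at the deep depth `k′`
    (κu : Finset (HeightOneSpectrum (𝓞 ℚ)) →
      galoisCohomology (W.torsionGaloisModule (((3 : ℕ) : ℤ) ^ k' * ((3 : ℕ) : ℤ))) 1)
    (Λu : galoisCohomology ((W.torsionGaloisModule (((3 : ℕ) : ℤ) ^ k' * ((3 : ℕ) : ℤ))).toLocal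
      (Sum.inr v₃)) 1 →+ ZMod (3 ^ (k' + 1)))
    (κu' : Finset (HeightOneSpectrum (𝓞 ℚ)) →
      galoisCohomology (W.torsionGaloisModule (((3 : ℕ) : ℤ) ^ k' * ((3 : ℕ) : ℤ))) 1)
    (hKS' : κu' ∈ D'.kolyvaginSystems (propagatedSelmerStructure W 3 k'))
    (hbr₀' : κu' ∅ = κu ∅)
    (hon' : ∀ r : ZMod (3 ^ (k' + 1)), ∃ x ∈ propagatedSelmerStructure W 3 k' (Sum.inr v₃), Λu x = r)
    (hker' : ∀ x ∈ propagatedSelmerStructure W 3 k' (Sum.inr v₃),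
      Λu x = 0 ↔ x ∈ W.kummerSelmerStructure (((3 : ℕ) : ℤ) ^ k' * ((3 : ℕ) : ℤ)) (Sum.inr v₃))
    (hdict₀' : ∃ (u : (ZMod (3 ^ (k' + 1)))ˣ)
        (ψ : (ℓ : ℕ) → (ZMod ℓ)ˣ →* Multiplicative (ZMod (3 ^ (k' + 1)))),
        ((3 ^ e : ℕ) : ZMod (3 ^ (k' + 1))) *
            Λu (galoisCohomology.localization _ (Sum.inr v₃) 1 (κu ∅)) =
          (u : ZMod (3 ^ (k' + 1))) * (3 : ZMod (3 ^ (k' + 1))) ^ t *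
            kuriharaNumber P.f (3 ^ (k' + 1)) 1 ψ)
    -- (COMP) one Euler system: the deep Kolyvagin system reduces to the shallow one
    (hcomp : ∀ d, D'.IsLevel d → D.IsLevel d → galoisCohomology.map red 1 (κu' d) = κ' d)
    -- generators of `KS₁` at the two levels
    (g : Finset (HeightOneSpectrum (𝓞 ℚ)) →
      galoisCohomology (W.torsionGaloisModule (((3 : ℕ) : ℤ) ^ k * ((3 : ℕ) : ℤ))) 1)
    (hgen : ∀ κ₁ ∈ D.kolyvaginSystems (propagatedSelmerStructure W 3 k), ∃ a : ℕ, κ₁ = a • g)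
    (g' : Finset (HeightOneSpectrum (𝓞 ℚ)) →
      galoisCohomology (W.torsionGaloisModule (((3 : ℕ) : ℤ) ^ k' * ((3 : ℕ) : ℤ))) 1)
    (hg' : g' ∈ D'.kolyvaginSystems (propagatedSelmerStructure W 3 k'))
    (hgen' : ∀ κ₁ ∈ D'.kolyvaginSystems (propagatedSelmerStructure W 3 k'), ∃ a : ℕ, κ₁ = a • g')
    -- the Poitou–Tate family at the deep modulus, `hEP`, an admissible `T`
    (inv' : LocalInvariants ℚ (3 ^ (k' + 1))) (hperf' : inv'.IsPerfect)
    (hsum' : inv'.SumLocalTermEqZero) (hcompl' : inv'.SelmerComplement)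
    (hinj' : ∀ v : HeightOneSpectrum (𝓞 ℚ), Injective (inv' (Sum.inr v)))
    (hEP : ∀ v : HeightOneSpectrum (𝓞 ℚ), localEulerPoincareCharacteristic (v.adicCompletion ℚ))
    (T : Finset (HeightOneSpectrum (𝓞 ℚ))) (hv₃T : v₃ ∈ T)
    (hT : ∀ v : HeightOneSpectrum (𝓞 ℚ), v ∉ T →
      (((3 ^ (k' + 1) : ℕ) : ℕ) : 𝓞 ℚ) ∉ v.asIdeal ∧
        GaloisRep.IsUnramifiedAt v (W.torsionGaloisModule (((3 : ℕ) : ℤ) ^ k' * ((3 : ℕ) : ℤ))))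
    (h𝓕T : (propagatedSelmerStructure W 3 k').IsUnramifiedOutside (finSupport T))
    (h𝓚T : (W.kummerSelmerStructure (((3 : ℕ) : ℤ) ^ k' * ((3 : ℕ) : ℤ))).IsUnramifiedOutside
      (finSupport T))
    [Finite (geomTorsion W (((3 : ℕ) : ℤ) ^ k' * ((3 : ℕ) : ℤ)))]
    [Finite (W.kummerSelmerStructure (((3 : ℕ) : ℤ) ^ k' * ((3 : ℕ) : ℤ))).selmerGroup]
    -- Thm. 4.4 (2) at `(k′, ∅)` in ORDER form for `g′`
    (hR22 : (Nat.card (inv'.dualSelmerStructure (W.torsionGaloisModule (((3 : ℕ) : ℤ) ^ k' * ((3 : ℕ) : ℤ)))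
          (propagatedSelmerStructure W 3 k')).selmerGroup ∣ 3 ^ (k' + 1) →
        addOrderOf (g' ∅) * Nat.card (inv'.dualSelmerStructure
          (W.torsionGaloisModule (((3 : ℕ) : ℤ) ^ k' * ((3 : ℕ) : ℤ)))
            (propagatedSelmerStructure W 3 k')).selmerGroup = 3 ^ (k' + 1)) ∧
      (3 ^ (k' + 1) ∣ Nat.card (inv'.dualSelmerStructure
          (W.torsionGaloisModule (((3 : ℕ) : ℤ) ^ k' * ((3 : ℕ) : ℤ)))
            (propagatedSelmerStructure W 3 k')).selmerGroup → g' ∅ = 0))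
    (hNp : ∃ l, Nat.card (inv'.dualSelmerStructure
        (W.torsionGaloisModule (((3 : ℕ) : ℤ) ^ k' * ((3 : ℕ) : ℤ)))
          (propagatedSelmerStructure W 3 k')).selmerGroup = 3 ^ l)
    -- the scalar transport through a common core vertex (p11)
    (htr : ∀ (κ₁ : Finset (HeightOneSpectrum (𝓞 ℚ)) →
        galoisCohomology (W.torsionGaloisModule (((3 : ℕ) : ℤ) ^ k * ((3 : ℕ) : ℤ))) 1)
      (κ₂ : Finset (HeightOneSpectrum (𝓞 ℚ)) →
        galoisCohomology (W.torsionGaloisModule (((3 : ℕ) : ℤ) ^ k' * ((3 : ℕ) : ℤ))) 1)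
      (a a' : ℕ), κ₁ ∈ D.kolyvaginSystems (propagatedSelmerStructure W 3 k) →
        κ₂ ∈ D'.kolyvaginSystems (propagatedSelmerStructure W 3 k') →
        κ₁ = a • g → κ₂ = a' • g' →
        (∀ d, D'.IsLevel d → D.IsLevel d → galoisCohomology.map red 1 (κ₂ d) = κ₁ d) →
        ∀ s, s ≤ k + 1 → (3 ^ s ∣ a ↔ 3 ^ s ∣ a'))
    -- the certificate at a level `n` of `D`
    (n : Finset (HeightOneSpectrum (𝓞 ℚ))) (hn : D.IsLevel n) {j : ℕ} (htj : t + j ≤ k + 1)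
    (hden : ∀ d ⊆ n, ∀ a : ℕ,
      (ratPlusSymbol P.f ((a : ℚ) / (∏ q ∈ d, Ideal.absNorm q.asIdeal : ℕ))).den.Coprime (3 ^ (k + 1)))
    {ψ₀ : (ℓ : ℕ) → (ZMod ℓ)ˣ →* Multiplicative (ZMod (3 ^ j))}
    (hψ₀ : ∀ q ∈ n, Function.Surjective (ψ₀ (Ideal.absNorm q.asIdeal)))
    (hcert : haveI : NeZero (∏ q ∈ n, Ideal.absNorm q.asIdeal) :=
        ⟨Finset.prod_ne_zero_iff.2 fun q _ => absNorm_ne_zero q⟩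
      kuriharaNumber P.f (3 ^ j) (∏ q ∈ n, Ideal.absNorm q.asIdeal) ψ₀ ≠ 0)
    (hv : ∀ c, c ⊂ n → ∀ ψ' : (ℓ : ℕ) → (ZMod ℓ)ˣ →* Multiplicative (ZMod (3 ^ j)),
      (∀ q ∈ c, Function.Surjective (ψ' (Ideal.absNorm q.asIdeal))) →
        haveI : NeZero (∏ q ∈ c, Ideal.absNorm q.asIdeal) :=
          ⟨Finset.prod_ne_zero_iff.2 fun q _ => absNorm_ne_zero q⟩
        kuriharaNumber P.f (3 ^ j) (∏ q ∈ c, Ideal.absNorm q.asIdeal) ψ' = 0)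
    -- the `L`-value at the deep modulus
    {v : ℕ} (hLval : ∃ w₀ : (ZMod (3 ^ (k' + 1)))ˣ, ∀ ψ : (ℓ : ℕ) → (ZMod ℓ)ˣ →* Multiplicative (ZMod (3 ^ (k' + 1))),
      kuriharaNumber P.f (3 ^ (k' + 1)) 1 ψ = ((3 ^ v : ℕ) : ZMod (3 ^ (k' + 1))) * (w₀ : ZMod _))
    -- exponent of the deep Selmer group, and the depth
    {X : ℕ} (hX : ∀ s ∈ (W.kummerSelmerStructure (((3 : ℕ) : ℤ) ^ k' * ((3 : ℕ) : ℤ))).selmerGroup,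
      3 ^ X • s = 0)
    (hK : X + t + v < k' + 1) :
    3 ^ (v + 1 - j) ∣
      Nat.card (W.kummerSelmerStructure (((3 : ℕ) : ℤ) ^ k' * ((3 : ℕ) : ℤ))).selmerGroup := by
  haveI : Fact (Nat.Prime 3) := ⟨Nat.prime_three⟩
  -- trivial when `j > v`
  rcases Nat.lt_or_ge v j with hvj | hjv
  · rw [show v + 1 - j = 0 by omega, pow_zero]; exact one_dvd _
  -- Kato's systems on the generators
  obtain ⟨a, ha⟩ := hgen κ' hKS
  obtain ⟨a', ha'⟩ := hgen' κu' hKS'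
  -- the SCALED functional `L = 3^e · (Λ ∘ loc_{v₃})` carries the one-exponent value law
  set L : galoisCohomology (W.torsionGaloisModule (((3 : ℕ) : ℤ) ^ k * ((3 : ℕ) : ℤ))) 1 →+
      ZMod (3 ^ (k + 1)) :=
    (AddMonoidHom.mulLeft ((3 ^ e : ℕ) : ZMod (3 ^ (k + 1)))).comp
      (Λ.comp (galoisCohomology.localization _ (Sum.inr v₃) 1)) with hLdef
  have hLapp : ∀ x, L x = ((3 ^ e : ℕ) : ZMod (3 ^ (k + 1))) *
      Λ (galoisCohomology.localization _ (Sum.inr v₃) 1 x) := fun x => rfl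
  -- SHALLOW (n1011's level-wise certificate lemma, for `L`): `L(κ′_n) ∉ (3^{t+j})`
  have hLn : L (κ' n) ∉ Ideal.span {((3 ^ (t + j) : ℕ) : ZMod (3 ^ (k + 1)))} := by
    refine (Shallow.not_pow_dvd_of_certificate_levelwise (p := 3) P.f L κ κ'
      (fun q : HeightOneSpectrum (𝓞 ℚ) => Ideal.absNorm q.asIdeal) n absNorm_ne_zero
      (fun q _ => FSComp.prime_absNorm_rat q) (absNorm_injOn _) hden ?_ (hbr n hn) (g := g n)
      (a := a) (by rw [ha]; rfl) htj hψ₀ hcert hv).1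
    intro d hd
    have hdl : D.IsLevel d := fun q hq => hn (hd hq)
    obtain ⟨u, ψ, hψ, hLd⟩ := hdictk d hdl
    exact ⟨u, ψ, hψ, by simpa [hLapp] using hLd⟩
  -- hence `e < t + j` (as `L(κ′_n) ∈ (3^e)`)
  have hetj : e < t + j := by
    by_contra hle
    apply hLn
    rw [Ideal.mem_span_singleton, hLapp]
    exact dvd_mul_of_dvd_left (Nat.cast_dvd_cast (Nat.pow_dvd_pow 3 (not_lt.mp hle))) _
  -- the SHARP certificate for Kato's scalar: `¬ 3^{t+j−e} ∣ a`
  have hshallow : ¬ 3 ^ (t + j - e) ∣ a := by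
    rintro ⟨c, hc⟩
    apply hLn
    rw [Ideal.mem_span_singleton, hLapp]
    have hκn : κ' n = a • g n := by rw [ha]; rfl
    rw [hκn, map_nsmul, map_nsmul, nsmul_eq_mul, hc]
    refine ⟨(c : ZMod (3 ^ (k + 1))) * Λ (galoisCohomology.localization _ (Sum.inr v₃) 1 (g n)), ?_⟩
    have hsplit : ((3 ^ (t + j) : ℕ) : ZMod (3 ^ (k + 1))) =
        ((3 ^ e : ℕ) : ZMod (3 ^ (k + 1))) * ((3 ^ (t + j - e) : ℕ) : ZMod (3 ^ (k + 1))) := by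
      rw [← Nat.cast_mul, ← pow_add, Nat.add_sub_cancel' hetj.le]
    rw [hsplit]
    push_cast
    ring
  -- transport to the deep depth: `¬ 3^{t+j−e} ∣ a′`
  have htr' := htr κ' κu' a a' hKS hKS' ha ha' hcomp (t + j - e) (by omega)
  have hcert' : ¬ 3 ^ (t + j - e) ∣ a' := fun h => hshallow (htr'.2 h)
  -- DEEP
  obtain ⟨w₀, hw₀⟩ := hLval
  obtain ⟨u0, ψ0, hL0⟩ := hdict₀'
  have htv : t + v < k' + 1 := by omega
  have hcount := DeepLedger.natCard_selmerGroup_propagated_eq W 3 k' (by norm_num) hv₃ Λu hon' hker'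
    inv' hperf' hsum' hcompl' hinj' hEP T hv₃T hT h𝓕T h𝓚T
  -- `Λu(loc κu_∅) = a′ · Λu(loc g′_∅)`
  have hκu : κu ∅ = a' • g' ∅ := by rw [← hbr₀', ha']; rfl
  have h1 : Λu (galoisCohomology.localization _ (Sum.inr v₃) 1 (κu ∅)) =
      (a' : ZMod (3 ^ (k' + 1))) * Λu (galoisCohomology.localization _ (Sum.inr v₃) 1 (g' ∅)) := by
    rw [hκu, map_nsmul, map_nsmul, nsmul_eq_mul]
  -- the value law at `∅`: `3^e · a′ · Λu(loc g′_∅) = 3^{t+v} · (u0 w₀)`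
  have hval0 : ((3 ^ e : ℕ) : ZMod (3 ^ (k' + 1))) * ((a' : ZMod (3 ^ (k' + 1))) *
      Λu (galoisCohomology.localization _ (Sum.inr v₃) 1 (g' ∅))) =
      ((3 ^ (t + v) : ℕ) : ZMod (3 ^ (k' + 1))) * ((u0 * w₀ : (ZMod (3 ^ (k' + 1)))ˣ) : ZMod _) := by
    rw [← h1, hL0, hw₀ ψ0, Units.val_mul]
    push_cast
    ring
  -- `a′ ≠ 0`, `a′ = 3^α b`, `3 ∤ b`, `α < t + j − e`
  have ha0 : a' ≠ 0 := by
    rintro rfl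
    rw [Nat.cast_zero, zero_mul, mul_zero] at hval0
    exact DeepLedger.pow_mul_unit_ne_zero 3 htv _ hval0.symm
  obtain ⟨α, b, hb, hab⟩ := Nat.exists_eq_pow_mul_and_not_dvd ha0 3 (by norm_num)
  have hα : α < t + j - e := by
    by_contra hle
    exact hcert' (hab ▸ (Nat.pow_dvd_pow 3 (not_lt.mp hle)).mul_right b)
  have hval : ((3 ^ (e + α) * b : ℕ) : ZMod (3 ^ (k' + 1))) *
      Λu (galoisCohomology.localization _ (Sum.inr v₃) 1 (g' ∅)) =
      ((3 ^ (t + v) : ℕ) : ZMod (3 ^ (k' + 1))) * ((u0 * w₀ : (ZMod (3 ^ (k' + 1)))ˣ) : ZMod _) := by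
    rw [← hval0, hab]
    push_cast
    ring
  obtain ⟨w', hw'⟩ := Ledger.exists_eq_pow_mul_unit_of_natCast_mul_eq (p := 3) htv
    (show e + α ≤ t + v by omega) hb _ (u0 * w₀) hval
  -- the deep ledger with `β = t + v − (e + α) ≥ v + 1 − j`
  have hβ := DeepLedger.pow_dvd_natCard_selmerGroup_kummer W 3 k' (by norm_num) hv₃ Λu hker' hNp hcount
    (KolyvaginDatum.IsKolyvaginSystem.apply_empty_mem hg') hR22 (β := t + v - (e + α)) (by omega) w' hw' hX
    (by omega)
  exact (Nat.pow_dvd_pow 3 (by omega)).trans hβ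

end Summit.BirchSwinnertonDyer.BirchSwinnertonDyer.Theorems.KimAtThreeTwoExponentAssembly

end
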